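import Summits.ResolutionOfSingularities.ResolutionOfSingularities.Theorems.PurelyInseparableDim4ResConeSupportConfinedRepresentation
import HarnessLib
import HarnessLib.Audit.Tags

/-!
# Purely inseparable four-folds — NO CONSTANT-SUPPORT BINARY-CONE TAIL: a constant-shade `e_G = 2` trap changes its NUMBER of boundary
# letters infinitely often, for EVERY prime `p` and EVERY shade `d < p`
# (K2(p) lane, slice C, rung-1 generic kill over the support-confined re-presentation; seat res-dim4-p-1 g6)

[OURS · counted 0 · cell `res-dim4-pi` · K2(p) lane (holder lineage res-dim4-p-12; rung-1 generic bricks «no `7` in a signature»,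
desk WORD #193 (δ)) · seat res-dim4-p-1 g6.]  Nothing here proves K2(p) = `RidgeBudget.NoAboveFloorTrap p p` for any `p ≥ 7`,
any TAIL(7, d, e), `NoIsolatedTrap p p`, the Cossart–Jannsen–Saito theorem or resolution of singularities in dimension ≥ 4 /
characteristic `p` — NOT proved; every theorem is about OUR frame's hypothetical `Step0 p` chains.  AI kernel work, weaker than
expert review.

THE OBSERVATION.  `support_representation_of_satellite` (`…ResConeSupportConfinedRepresentation`, p711054) gives every witnessed isolated
above-floor constant-shade `e_G ≡ 2` tail, from a late satellite time `kₑ`, an HONEST partner `c′` CONFINED to `S := supp r_{kₑ}` whose weights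
are the real weights RENAMED.  Renaming preserves the NUMBER of boundary letters.  So if the real tail has the SAME number `n` of boundary
letters at every late time, the partner has `n = #S` boundary letters inside `S` at every time, i.e. its support IS `S` for ever: no
virtual step ever drops a letter of `S`, and letters off `S` weigh `0` — the partner never translates a boundary letter, it is LOSS-FREE,
and res-dim4-p-5 g3's C13 `no_lossfree_tail p` (`d < p`) ends it.  The REAL tail may be as lossy as it likes (its support wandering among
the `n`-subsets of the four letters); only its letter COUNT is frozen.
* §1 `card_support_mapDomain_perm` (renaming keeps the letter count), `lossfree_of_confined_card_le` (a child confined to `S` with `≥ #S`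
  boundary letters has dropped nothing: `step_r_univ'`).
* §2 **`no_constant_support_tail (p)`** — no witnessed isolated above-floor `Step0 p` tail with `x^{r₀} ∣ F₀`, constant shade `d < p`,
  `e_G ≡ 2` and `#supp r_k = n` for every late `k`, whatever `n` and whatever the weights.
* §3 **`support_card_le_of_late_satellite (p)`** (no `d < p`): after a late satellite time the letter count never exceeds its value there;
  **`support_card_not_eventually_constant (p)`**: the letter count of a trap changes beyond every time; `no_fixed_support_tail`,
  `no_twoLetter_tail`, `no_threeLetter_tail` — named shapes for the census rows.
EXIT-TABLE READING (holder res-dim4-p-12 g5's RUNG-0 draft v0, by name, no `7` here): every SCC-orbit of the weight ledger ALL of whose states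
have the same support size carries no tail, at every `(p, d < p)` — the `(2,2)`-loop (twin pair; res-dim4-p-2 g6's statement layer
2026-08-29 09:23Z is the `n = 2` instance), the `(2,2,2)`-loop, the `(3,1)`/`(4,1)` loops, the `(3,1,1)` loop, the support-4 self-loops, and
the three light classes (pair p709143 · triple `…LightTripleAllPrimes` · quad p709936) uniformly; the ZOOS mix support sizes and survive
this file — they must oscillate (§3).
[cite: CossartJannsenSaito2020, Thm. 3.10(4), Thm. 3.14, Thm. 9.3, Lemma 13.2, Thm. 13.7] [cite: Hauser2010, §§F–G (chart expressions of a point blowup; cleaning)]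
bears_on: LADDER-RESOLUTION:D157-DOOR2 (res-dim4-pi · K2(p) = `RidgeBudget.NoAboveFloorTrap p p` · slice C · rung-1 generic: no
constant-support tail, every prime, every shade).  Supports stmt-ResolutionOfSingularities-16155 (helper).
-/

set_option linter.dupNamespace false -- mandated namespace of this single-conjunct summit

noncomputable section

namespace Summit.ResolutionOfSingularities.ResolutionOfSingularities.Theorems.PIDim4

namespace ResCone

open MvPolynomial Finset
open Literature.AlgebraicGeometry.Resolution
open Literature.AlgebraicGeometry.Resolution.CentreBlowup
open Literature.AlgebraicGeometry.Resolution.Hauser2010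
open Literature.AlgebraicGeometry.Resolution.HauserPerlega2019

variable {K : Type} [Field K] [DecidableEq K] (p : ℕ)

/-! ## §1 Bookkeeping -/

omit [DecidableEq K] in
/-- Renaming the letters keeps the number of boundary letters. [folklore] -/
theorem card_support_mapDomain_perm (π : Equiv.Perm (Fin 4)) (f : Fin 4 →₀ ℕ) :
    (Finsupp.mapDomain (Equiv.symm π) f).support.card = f.support.card := by
  classical
  rw [Finsupp.mapDomain_support_of_injective (Equiv.symm π).injective,
    Finset.card_image_of_injective _ (Equiv.symm π).injective]

/-- **A child confined to `S` with at least `#S` boundary letters has dropped nothing**: if `B` has no boundary letter off `S`, the point step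
charted at `ℓ` with translation `β` (`β ℓ = 0`) produces a child again with no boundary letter off `S` and with `≥ #S` boundary letters, then
`β` vanishes on every boundary letter of `B` — the step is loss-free. [OURS · bookkeeping] [cite: HauserPerlega2019PRIMS, §2 (transform D′ of D)] -/
theorem lossfree_of_confined_card_le (q : ℕ) {B : State K} {o : ℕ} (ho : ordZero B.F = o) {S : Finset (Fin 4)}
    (hconfB : ∀ i, i ∉ S → B.r i = 0) {ℓ : Fin 4} {β : Fin 4 → K} (hβℓ : β ℓ = 0)
    (hcard : S.card ≤ (CentreBlowup.step q Finset.univ ℓ β B).r.support.card)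
    (hconf' : ∀ i, i ∉ S → (CentreBlowup.step q Finset.univ ℓ β B).r i = 0) :
    ∀ i, β i ≠ 0 → B.r i = 0 := by
  intro i hβi
  by_contra hri
  have hiS : i ∈ S := by
    by_contra h
    exact hri (hconfB i h)
  have hiℓ : i ≠ ℓ := by
    rintro rfl
    exact hβi hβℓ
  have hsub : (CentreBlowup.step q Finset.univ ℓ β B).r.support ⊆ S := fun l hl => by
    by_contra hlS
    exact (Finsupp.mem_support_iff.mp hl) (hconf' l hlS)
  have heq : (CentreBlowup.step q Finset.univ ℓ β B).r.support = S := Finset.eq_of_subset_of_card_le hsub hcard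
  have hi' : (CentreBlowup.step q Finset.univ ℓ β B).r i ≠ 0 := by
    apply Finsupp.mem_support_iff.mp
    rw [heq]
    exact hiS
  rw [step_r_univ' q ℓ β B ho, Finsupp.coe_update, Function.update_of_ne hiℓ, Finsupp.filter_apply, if_neg hβi] at hi'
  exact hi' rfl

/-! ## §2 The kill -/

variable [Fact p.Prime] [CharP K p]

/-- **NO CONSTANT-SUPPORT BINARY-CONE TAIL, every prime `p`, every shade `d < p`.**  Over a field of characteristic `p`, no witnessed
isolated above-floor `Step0 p` chain with `x^{r₀} ∣ F₀` has, from some `k₀` on, constant shade `d < p`, `e_G ≡ 2`, and the SAME NUMBER `n` of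
boundary letters at every time — whatever `n`, whatever the weights, however the support moves.  Route: `support_representation_of_satellite`
→ the `S`-confined partner keeps `#S` letters inside `S` (`card_support_mapDomain_perm`), so its support is `S` for ever → loss-free
(`lossfree_of_confined_card_le`) → C13 `no_lossfree_tail`. [OURS]
[cite: CossartJannsenSaito2020, Thm. 3.10(4), Thm. 3.14, Thm. 9.3, Lemma 13.2, Thm. 13.7] [cite: Hauser2010, §§F–G (chart expressions of a point blowup; cleaning)] -/
theorem no_constant_support_tail {c : ℕ → State K} {j : ℕ → Fin 4} {b : ℕ → Fin 4 → K}
    (hc : ∀ k, IsIsolated p (c k).F ∧ Step0 p (c k) (c (k + 1))) (hw : FreeTail.IsWitnessedChain p c j b)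
    (hr0 : ∀ e ∈ (c 0).F.support, (c 0).r ≤ e) (hfloor : ∀ k, ordZero (c k).F ≠ p) {k₀ d : ℕ} (hdp : d < p)
    (hshade : ∀ k, k₀ ≤ k → (c k).shade = (d : ℕ∞)) (he : ∀ k, k₀ ≤ k → Module.finrank K (resVertex (c k)) = 2)
    {n : ℕ} (hcard : ∀ k, k₀ ≤ k → (c k).r.support.card = n) : False := by
  -- (1) the support-confined honest partner from a late satellite time
  obtain ⟨kₑ, c', j', b', hke, -, hperm, hconf, -, -, hc', hw', hr0', hfloor', hshade', he'⟩ :=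
    support_representation_of_satellite p hc hw hr0 hfloor hshade he (le_refl k₀)
  have hstep' : ∀ t, c' (t + 1) = CentreBlowup.step p Finset.univ (j' t) (b' t) (c' t) := fun t => (hw' t).2.2.2.2
  -- (2) the partner has `n = #S` boundary letters at every time
  have hcardS : (c kₑ).r.support.card = n := hcard kₑ hke
  have hcard' : ∀ t, (c' t).r.support.card = n := fun t => by
    obtain ⟨π, hr⟩ := hperm t
    rw [hr, card_support_mapDomain_perm]
    exact hcard (kₑ + t) (by omega)
  -- (3) hence loss-free
  have hloss : ∀ t, 0 ≤ t → ∀ i, b' t i ≠ 0 → (c' t).r i = 0 := by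
    intro t _
    obtain ⟨o, ho, -, -⟩ := chain_band p hc' hfloor' t
    refine lossfree_of_confined_card_le p ho (hconf t) (hw' t).2.1 ?_ fun i hi => ?_
    · rw [← hstep' t, hcard' (t + 1), ← hcardS]
    · rw [← hstep' t]
      exact hconf (t + 1) i hi
  -- (4) C13
  exact no_lossfree_tail p hc' hw' hr0' hfloor' hdp (k₀ := 0) hshade' he' hloss

/-! ## §3 Corollaries: the letter count of a trap -/

omit [CharP K p] in
/-- Renaming keeps the letter count along the support-confined partner: a confined renaming has AT MOST `#S` letters. [folklore] -/
theorem card_support_le_of_confined {f g : Fin 4 →₀ ℕ} {π : Equiv.Perm (Fin 4)} (hfg : f = Finsupp.mapDomain (Equiv.symm π) g)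
    {S : Finset (Fin 4)} (hconf : ∀ i, i ∉ S → f i = 0) : g.support.card ≤ S.card := by
  have hsub : f.support ⊆ S := fun l hl => by
    by_contra hlS
    exact (Finsupp.mem_support_iff.mp hl) (hconf l hlS)
  have h := Finset.card_le_card hsub
  rwa [hfg, card_support_mapDomain_perm] at h

/-- **AFTER A LATE SATELLITE TIME THE LETTER COUNT NEVER EXCEEDS ITS VALUE THERE** (every prime `p`, every shade, no `d < p`): on a witnessed
isolated above-floor `Step0 p` chain with `x^{r₀} ∣ F₀`, constant shade `d` and `e_G ≡ 2` from `k₀`, for every `N ≥ k₀` there is `kₑ ≥ N` with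
`#supp r_k ≤ #supp r_{kₑ}` for all `k ≥ kₑ` — the partner is confined to `supp r_{kₑ}` and carries the real letter count. [OURS]
[cite: CossartJannsenSaito2020, Thm. 3.10(4), Thm. 3.14, Thm. 9.3] -/
theorem support_card_le_of_late_satellite {c : ℕ → State K} {j : ℕ → Fin 4} {b : ℕ → Fin 4 → K}
    (hc : ∀ k, IsIsolated p (c k).F ∧ Step0 p (c k) (c (k + 1))) (hw : FreeTail.IsWitnessedChain p c j b)
    (hr0 : ∀ e ∈ (c 0).F.support, (c 0).r ≤ e) (hfloor : ∀ k, ordZero (c k).F ≠ p) {k₀ d : ℕ}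
    (hshade : ∀ k, k₀ ≤ k → (c k).shade = (d : ℕ∞)) (he : ∀ k, k₀ ≤ k → Module.finrank K (resVertex (c k)) = 2)
    {N : ℕ} (hN : k₀ ≤ N) :
    ∃ kₑ, N ≤ kₑ ∧ ∀ k, kₑ ≤ k → (c k).r.support.card ≤ (c kₑ).r.support.card := by
  obtain ⟨kₑ, c', j', b', hke, -, hperm, hconf, -⟩ := support_representation_of_satellite p hc hw hr0 hfloor hshade he hN
  refine ⟨kₑ, hke, fun k hk => ?_⟩
  obtain ⟨π, hr⟩ := hperm (k - kₑ)
  have h := card_support_le_of_confined hr (hconf (k - kₑ))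
  rwa [show kₑ + (k - kₑ) = k by omega] at h

/-- **THE LETTER COUNT OF A TRAP IS NOT EVENTUALLY CONSTANT** (every prime `p`, every shade `d < p`): beyond every time `k₁ ≥ k₀` there is a
step `k ≥ k₁` changing the number of boundary letters. [OURS]
[cite: CossartJannsenSaito2020, Thm. 3.10(4), Thm. 3.14, Thm. 9.3, Lemma 13.2, Thm. 13.7] -/
theorem support_card_not_eventually_constant {c : ℕ → State K} {j : ℕ → Fin 4} {b : ℕ → Fin 4 → K}
    (hc : ∀ k, IsIsolated p (c k).F ∧ Step0 p (c k) (c (k + 1))) (hw : FreeTail.IsWitnessedChain p c j b)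
    (hr0 : ∀ e ∈ (c 0).F.support, (c 0).r ≤ e) (hfloor : ∀ k, ordZero (c k).F ≠ p) {k₀ d : ℕ} (hdp : d < p)
    (hshade : ∀ k, k₀ ≤ k → (c k).shade = (d : ℕ∞)) (he : ∀ k, k₀ ≤ k → Module.finrank K (resVertex (c k)) = 2)
    {k₁ : ℕ} (hk₁ : k₀ ≤ k₁) :
    ∃ k, k₁ ≤ k ∧ (c (k + 1)).r.support.card ≠ (c k).r.support.card := by
  by_contra hno
  push Not at hno
  refine no_constant_support_tail p hc hw hr0 hfloor hdp (k₀ := k₁) (fun k hk => hshade k (by omega))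
    (fun k hk => he k (by omega)) (n := (c k₁).r.support.card) fun k hk => ?_
  induction k, hk using Nat.le_induction with
  | base => rfl
  | succ k hk ih => rw [hno k hk, ih]

/-- **NO FIXED-SUPPORT TAIL** (every prime `p`, every shade `d < p`): the boundary support of a trap is not eventually one fixed letter set.
[OURS] [cite: CossartJannsenSaito2020, Thm. 3.10(4), Thm. 3.14, Thm. 9.3, Lemma 13.2, Thm. 13.7] -/
theorem no_fixed_support_tail {c : ℕ → State K} {j : ℕ → Fin 4} {b : ℕ → Fin 4 → K}
    (hc : ∀ k, IsIsolated p (c k).F ∧ Step0 p (c k) (c (k + 1))) (hw : FreeTail.IsWitnessedChain p c j b)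
    (hr0 : ∀ e ∈ (c 0).F.support, (c 0).r ≤ e) (hfloor : ∀ k, ordZero (c k).F ≠ p) {k₀ d : ℕ} (hdp : d < p)
    (hshade : ∀ k, k₀ ≤ k → (c k).shade = (d : ℕ∞)) (he : ∀ k, k₀ ≤ k → Module.finrank K (resVertex (c k)) = 2)
    {S : Finset (Fin 4)} (hS : ∀ k, k₀ ≤ k → (c k).r.support = S) : False :=
  no_constant_support_tail p hc hw hr0 hfloor hdp hshade he (n := S.card) fun k hk => by rw [hS k hk]

/-- **NO TWO-LETTER TAIL** (every prime `p`, every shade `d < p`): a trap cannot have EXACTLY TWO boundary letters at every late time, whatever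
their weights and however the pair moves — the twin pair `(p − d, p − d)`, the `(3,1)`/`(4,1)` loops and the light pair are instances. [OURS]
[cite: CossartJannsenSaito2020, Thm. 3.10(4), Thm. 3.14, Thm. 9.3, Lemma 13.2, Thm. 13.7] -/
theorem no_twoLetter_tail {c : ℕ → State K} {j : ℕ → Fin 4} {b : ℕ → Fin 4 → K}
    (hc : ∀ k, IsIsolated p (c k).F ∧ Step0 p (c k) (c (k + 1))) (hw : FreeTail.IsWitnessedChain p c j b)
    (hr0 : ∀ e ∈ (c 0).F.support, (c 0).r ≤ e) (hfloor : ∀ k, ordZero (c k).F ≠ p) {k₀ d : ℕ} (hdp : d < p)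
    (hshade : ∀ k, k₀ ≤ k → (c k).shade = (d : ℕ∞)) (he : ∀ k, k₀ ≤ k → Module.finrank K (resVertex (c k)) = 2)
    (h2 : ∀ k, k₀ ≤ k → ∃ a a' : Fin 4, a ≠ a' ∧ (c k).r a ≠ 0 ∧ (c k).r a' ≠ 0 ∧
      ∀ i, i ≠ a → i ≠ a' → (c k).r i = 0) : False := by
  refine no_constant_support_tail p hc hw hr0 hfloor hdp hshade he (n := 2) fun k hk => ?_
  obtain ⟨a, a', haa, ha, ha', hoth⟩ := h2 k hk
  rw [Finset.card_eq_two]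
  refine ⟨a, a', haa, ?_⟩
  ext i
  rw [Finsupp.mem_support_iff, Finset.mem_insert, Finset.mem_singleton]
  constructor
  · intro hi
    by_contra hne
    push Not at hne
    exact hi (hoth i hne.1 hne.2)
  · rintro (rfl | rfl)
    · exact ha
    · exact ha'

/-- **NO THREE-LETTER TAIL** (every prime `p`, every shade `d < p`): a trap cannot have EXACTLY THREE boundary letters at every late time — the
`(2,2,2)`-loop, the `(3,1,1)`-loop and the light triple are instances. [OURS]
[cite: CossartJannsenSaito2020, Thm. 3.10(4), Thm. 3.14, Thm. 9.3, Lemma 13.2, Thm. 13.7] -/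
theorem no_threeLetter_tail {c : ℕ → State K} {j : ℕ → Fin 4} {b : ℕ → Fin 4 → K}
    (hc : ∀ k, IsIsolated p (c k).F ∧ Step0 p (c k) (c (k + 1))) (hw : FreeTail.IsWitnessedChain p c j b)
    (hr0 : ∀ e ∈ (c 0).F.support, (c 0).r ≤ e) (hfloor : ∀ k, ordZero (c k).F ≠ p) {k₀ d : ℕ} (hdp : d < p)
    (hshade : ∀ k, k₀ ≤ k → (c k).shade = (d : ℕ∞)) (he : ∀ k, k₀ ≤ k → Module.finrank K (resVertex (c k)) = 2)
    (h3 : ∀ k, k₀ ≤ k → ∃ y : Fin 4, (c k).r y = 0 ∧ ∀ i, i ≠ y → (c k).r i ≠ 0) : False := by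
  refine no_constant_support_tail p hc hw hr0 hfloor hdp hshade he (n := 3) fun k hk => ?_
  obtain ⟨y, hy, hoth⟩ := h3 k hk
  have hsupp : (c k).r.support = Finset.univ.erase y := by
    ext i
    rw [Finsupp.mem_support_iff, Finset.mem_erase]
    constructor
    · intro hi
      exact ⟨fun h => hi (h ▸ hy), Finset.mem_univ i⟩
    · intro hi
      exact hoth i hi.1
  rw [hsupp, Finset.card_erase_of_mem (Finset.mem_univ y), Finset.card_univ, Fintype.card_fin]

end ResCone

end Summit.ResolutionOfSingularities.ResolutionOfSingularities.Theorems.PIDim4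

end
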